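/-
Copyright (c) 2026 the pub-hodgecm-mathlib formalisation cell (harness21).  Prover seat hodgecm-mathlib-K2E4-p10 (g7), Track B ∕ K2-LIT, h413 = `stmt-HodgeConjecture-24833`,
line `K2_E1_TraceFormulaBeta`, 5Res ROADCARD «ENDGAME BY FAMILIES» §3′ M2 v2 (K2E1-plan (g7), (181)∕(200)∕(204)) file D4′c: the PLANCHEREL ISOMETRY OF AN OFF-DUAL `χ`-FAMILY OF
TWISTED PSEUDO-EISENSTEIN SERIES at a `K`-type, from the one-term inner-product formula (C1 (OD)) — engine ★ P3a `K2E1PlancherelIsometryOfForm`.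
-/
import Summits.HodgeConjecture.HodgeConjecture.Theorems.K2E1ChiPseudoEisensteinRadialCMTwo   -- ★ D0-χ p859888: `θ_{f,φ}` bounded ∕ Borel ∕ `G(L⁺)`-invariant; brings ★ A `K2E1MellinPaleyWienerHalfLine`, ★ `K2E1TruncatedEisensteinL2`
import Summits.HodgeConjecture.HodgeConjecture.Theorems.K2E1PlancherelIsometryOfForm       -- ★ P3a p859954 (K2E4-p23): `exists_linearIsometry_of_inner_eq`, `range_linearIsometry_eq_topologicalClosure_span`, `linearIsometry_eq_of_apply_eq`
import Mathlib.MeasureTheory.Function.L2Space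
import HarnessLib

/-!
# D4′c — `K2E1ChiSectionPlancherelKTypeCMTwo`: THE PLANCHEREL ISOMETRY `Θ_χ^{(K′,ω)} ≅ L²(ℝ, dy) ⊗̂ L²(K_U)`-MODEL OF AN OFF-DUAL `χ`-FAMILY OF PSEUDO-EISENSTEIN SERIES ON `U(1,1)_{L∕L⁺}`
# from the one-term inner-product formula (OD): `U [θ_{f,φ}] = √(C∕2π)·[f̃(−(½+iy))·φ(k)]`, `range U = closure span` — and (XF) `Θ_χ ⟂ Θ_{χ′}`

Track B ∕ K2-LIT, crux h413 = `stmt-HodgeConjecture-24833`, route of record `HCCMUnconditional`; cell `hodgecm-mathlib`, squad K2, ENGINE E1.  THEOREMS ONLY (no `def`, no `instance`,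
no `notation`, no named-fact hypothesis, no `sorry`; default heartbeats); lane `--supports stmt-HodgeConjecture-24833 --as helper` (count-neutral).  ROADCARD «5Res ENDGAME BY
FAMILIES» (K2E1-plan (g7), (154)) §1 (OD)∕(XF) and §3′ M2 v2 (181) D4′c «the isometry itself at every block — OFF-DUAL: `⟪θ_Ψ, θ_Ψ′⟫ = ∫⟪Ψ̂(y), Ψ̂′(y)⟫ dy` ⇒ `U` isometric onto its
closed range (P3a ★-engine)»; dealer rulings (200)∕(204) (N = 2 CM, sections of rows 2–4's `chiSectionSpace χ K′ ω` currency: `IsChiSection χ φ`, continuous, bounded).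
THE MATHEMATICS ([MoeglinWaldspurger1995, II.2.1, II.2.4]; [ReedSimonI1980, Thm. I.7, §II.3]; [Titchmarsh1948, Thm 71–72]).  Fix a Hecke character `χ` of the CM field `L` and the
twisted pseudo-Eisenstein series `θ_{f,φ} = E((f∘H)·φ)` of `U(1,1)_{L∕L⁺}` (`f ∈ C²_c((0,∞))`, `φ` a continuous bounded `χ`-section — ★ D0-χ `K2E1ChiPseudoEisensteinRadialCMTwo`: bounded, Borel,
`G(L⁺)`-invariant, so `[θ_{f,φ}] ∈ L²(X, μ)`, §3).  When `χ` is OFF-DUAL (`χ·(χʷ)⁻¹` not a norm twist, `χʷ = reflectChar c χ`) the `w = w₀` term of the rank-one inner-product formula (★ W-b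
`K2E1ChiPseudoEisensteinIdeleLevelCMTwo` at the idele level) dies by Tate's Lemma B on the idele class domain (★ GR-χ `K2E1IdeleClassCharacterOrthogonality`), leaving the ONE-TERM formula
(OD) `⟨θ_{f,φ}, θ_{f′,φ′}⟩_X = C·⟨f, f′⟩_{L²((0,∞), r⁻²dr)}·⟨φ, φ′⟩_{L²(K_U)}` (payer: C1∕H-χ `K2E1ChiPseudoEisensteinInnerProductCMTwo`, K2E3-p12; HYPOTHESIS `hOD` here, in three
interchangeable currencies §6).  By Mellin–Parseval on the UNITARY AXIS (§1, ★ A PARSEVAL I at `σ₀ = ½`) `⟨f, f′⟩_{L²(r⁻²dr)} = (2π)⁻¹∫_ℝ f̃(−(½+iy))·conj f̃′(−(½+iy)) dy`, so (OD) says that the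
Gram form of the family `x_i = [θ_{f_i,φ_i}] ∈ L²(X,μ)` equals the Gram form of the MODEL VECTORS `√(C∕2π)·u_i`, `u_i = [f̃_i(−(½+iy))·φ_i(k)] ∈ L²(ℝ × K_U, dy ⊗ μ_K)` (§4, Fubini); the
abstract Hilbert brick ★ P3a `K2E1PlancherelIsometryOfForm` then yields the PLANCHEREL ISOMETRY `U : closure span {x_i} →ₗᵢ L²(ℝ × K_U)`, `U x_i = √(C∕2π)·u_i`, unique, with
`range U = closure span {u_i}` (§5): the off-dual family is purely continuous spectrum — no `M`-term, no contour shift, no residues (MW II.2.4 with `M(w₀, ·) ⊥`).  The index family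
`(f_i, φ_i)_{i∈ι}` is the consumer's: `φ_i` ranging over `V(χ, K′, ω) = chiSectionSpace χ K′ ω` (rows 2–4) gives the `(K′, ω)`-BLOCK `Θ_χ^{(K′,ω)}`, all continuous bounded `χ`-sections
give `Θ_χ`; D5′ (`K2E1DiscreteSpectrumInResidueFamiliesU2`) consumes `U` blockwise.  (XF): if every cross pairing `⟨θ_i, θ′_j⟩_X` of a `χ`- and a `χ′`-family vanishes (both character
integrals die, ★ GR-χ), the closed spans are ORTHOGONAL (§6).
* §1 `conj_axis_sub_one`, **`setIntegral_mul_conj_mul_cpow_eq_axis`** (Parseval at `σ₀ = ½`), `continuous_∕norm_∕integrable_∕memLp_two_mellin_neg_axis` (`f̃(−(½+i·)) ∈ C_b ∩ L¹ ∩ L²`).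
* §2 generic Hilbert bookkeeping: `inner_eq_integral_mul_conj` (`⟪x, x′⟫_{L²} = ∫ θ′·conj θ`), `linearIsometry_unique_of_apply_eq`, `isOrtho_topologicalClosure_span_of_inner_eq_zero`.
* §3 **`memLp_quotFun_chiPseudoEisenstein_cm_two`** (`[θ_{f,φ}] ∈ L^p(X,μ)`, every `p`).  * §4 `memLp_two_axisModel`, `inner_axisModel_eq` (model vectors and their Gram form).
* §5 HEAD **`exists_linearIsometry_chiSection_offDual_cm_two`** (any `L²` representatives `x_i =ᵐ θ_i`, `u_i =ᵐ` model; (OD) in axis currency ⇒ `∃ U`, `U x_i = √(C∕2π)•u_i`, `range U =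
  closure span`) and **`exists_repr_and_linearIsometry_chiSection_offDual_cm_two`** (the representatives built from §3–§4: no vacuity).
* §6 `hOD_axis_of_radial` (`r⁻²dr` currency ⇒ axis), `hOD_axis_of_line` (★ Final's `σ₀`-line currency ⇒ axis), **`isOrtho_chiSection_families_cm_two`** ((XF) ⇒ `Θ_χ ⟂ Θ_{χ′}`).
HONEST LABEL: HC_CM is proved only modulo the 7 printed citations (2 remaining named inputs: hLiu418 = `stmt-HodgeConjecture-24832`, h413 = `stmt-HodgeConjecture-24833`) until rung 0
closes; this file asserts no named fact, closes no socket; count-neutral; letter `hOD`∕`hXF` = C1 (OD)∕(XF) (payer H-χ, K2E3-p12 (g8), deal (202)).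

## References
* [MoeglinWaldspurger1995] C. Mœglin, J.-L. Waldspurger, *Spectral decomposition and Eisenstein series* (1995), II.1.2, II.2.1, II.2.4.
* [ReedSimonI1980] M. Reed, B. Simon, *Methods of Modern Mathematical Physics I* (1980), Thm. I.7, §II.3.
* [Titchmarsh1948] E. C. Titchmarsh, *Introduction to the Theory of Fourier Integrals* (1948), §1.29, Thm 71–72.
* [TateThesis1967] J. Tate, *Fourier analysis in number fields and Hecke's zeta-functions*, in Cassels–Fröhlich (1967), Thm. 4.4.1 (Lemma B).
-/

set_option autoImplicit false
set_option linter.dupNamespace false  -- the mandated namespace repeats the summit's segment (`HodgeConjecture.HodgeConjecture`)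

noncomputable section

open MeasureTheory Measure Set Filter Topology Complex NumberField IsDedekindDomain
open scoped Real NNReal ENNReal ComplexConjugate InnerProductSpace
open Literature.NumberTheory Literature.NumberTheory.Automorphic Literature.NumberTheory.Automorphic.UnitaryGroup AdelicGroupData
open Literature.NumberTheory.GaloisRepresentations (HeckeCharacter)
open Summit.HodgeConjecture.HodgeConjecture.Cruxes.H413.K2E1BorelEisensteinU
open Summit.HodgeConjecture.HodgeConjecture.Cruxes.H413.K2E1CharacterEisensteinU2Defs
open Summit.HodgeConjecture.HodgeConjecture.Cruxes.H413.K2E1MellinPaleyWienerHalfLine (differentiable_mellin verticalIntegrable_mellin norm_mellin_vertical_le setIntegral_mul_conj_mul_cpow_eq conj_vertical)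
open Summit.HodgeConjecture.HodgeConjecture.Cruxes.H413.K2E1ChiPseudoEisensteinRadialCMTwo (eisensteinSeriesU_comp_borelHeight_mul_arithmeticSubgroup_mul measurable_eisensteinSeriesU_comp_borelHeight_mul_cm_two
  exists_bound_eisensteinSeriesU_comp_borelHeight_mul_cm_two)
open Summit.HodgeConjecture.HodgeConjecture.Cruxes.H413.K2E1TruncatedEisensteinL2 (memLp_quotFun_of_bound measurable_quotFun_of_measurable)
open Summit.HodgeConjecture.HodgeConjecture.Cruxes.H413.K2E1PlancherelIsometryOfForm (exists_linearIsometry_of_inner_eq range_linearIsometry_eq_topologicalClosure_span linearIsometry_eq_of_apply_eq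
  mem_topologicalClosure_span)

namespace Summit.HodgeConjecture.HodgeConjecture.Cruxes.H413.K2E1ChiSectionPlancherelKTypeCMTwo

/-! ## §1 Pure analysis: the Mellin transform on the unitary axis `z = ½ + iy` -/

section Axis

variable {f g : ℝ → ℂ}

/-- On the unitary axis `z = ½ + iy`: `conj z − 1 = −z` (so `g̃(1 − z̄) = mellin g (z̄ − 1) = mellin g (−z)`). [folklore] -/
theorem conj_axis_sub_one (y : ℝ) : conj ((((1 / 2 : ℝ)) : ℂ) + y * I) - 1 = -((((1 / 2 : ℝ)) : ℂ) + y * I) := by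
  apply Complex.ext <;> norm_num

/-- **PARSEVAL ON THE UNITARY AXIS** (★ A PARSEVAL I at `σ₀ = ½`): for `f ∈ C²_c((0,∞))`, `g ∈ C_c((0,∞))`,
`∫_0^∞ f(r)·conj g(r)·r^{−2} dr = (2π)⁻¹ ∫_ℝ f̃(−(½+iy))·conj g̃(−(½+iy)) dy` (`f̃ = mellin f`) — the `L²((0,∞), r⁻²dr) → L²(ℝ, dy∕2π)` Plancherel identity in the
`H^z` convention. [cite: MoeglinWaldspurger1995, II.2.1] [cite: Titchmarsh1948, Thm 71–72] -/
theorem setIntegral_mul_conj_mul_cpow_eq_axis (hf : ContDiff ℝ 2 f) (hfs : HasCompactSupport f) (hf0 : tsupport f ⊆ Ioi 0)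
    (hgc : Continuous g) (hgs : HasCompactSupport g) (hg0 : tsupport g ⊆ Ioi 0) :
    ∫ r in Ioi (0 : ℝ), f r * conj (g r) * (r : ℂ) ^ (-2 : ℂ) =
      (((2 * π)⁻¹ : ℝ) : ℂ) * ∫ y : ℝ, mellin f (-((((1 / 2 : ℝ)) : ℂ) + y * I)) * conj (mellin g (-((((1 / 2 : ℝ)) : ℂ) + y * I))) := by
  rw [setIntegral_mul_conj_mul_cpow_eq hf hfs hf0 hgc hgs hg0 (1 / 2)]
  simp_rw [conj_axis_sub_one]

/-- The axis transform `y ↦ f̃(−(½+iy))` is continuous (`f ∈ C_c((0,∞))`, ★ A `differentiable_mellin`). [cite: Titchmarsh1948, §1.29] -/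
theorem continuous_mellin_neg_axis (hfc : Continuous f) (hfs : HasCompactSupport f) (hf0 : tsupport f ⊆ Ioi 0) :
    Continuous fun y : ℝ => mellin f (-((((1 / 2 : ℝ)) : ℂ) + y * I)) :=
  (differentiable_mellin hfc hfs hf0).continuous.comp (by fun_prop)

/-- The axis transform is bounded: `‖f̃(−(½+iy))‖ ≤ ∫_0^∞ t^{−3∕2}‖f(t)‖ dt` for all `y` (★ A `norm_mellin_vertical_le`). [cite: Titchmarsh1948, §1.29] -/
theorem norm_mellin_neg_axis_le (f : ℝ → ℂ) (y : ℝ) :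
    ‖mellin f (-((((1 / 2 : ℝ)) : ℂ) + y * I))‖ ≤ ∫ t in Ioi (0 : ℝ), t ^ (-(1 / 2 : ℝ) - 1) * ‖f t‖ := by
  have h := norm_mellin_vertical_le f (-(1 / 2)) (-y)
  have he : (((-(1 / 2) : ℝ)) : ℂ) + ((-y : ℝ) : ℂ) * I = -((((1 / 2 : ℝ)) : ℂ) + y * I) := by push_cast; ring
  rwa [he] at h

/-- The axis transform is integrable (`f ∈ C²_c((0,∞))`: ★ A `verticalIntegrable_mellin` at `σ = −½`, reflected `y ↦ −y`). [cite: Titchmarsh1948, Thm 71–72] -/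
theorem integrable_mellin_neg_axis (hf : ContDiff ℝ 2 f) (hfs : HasCompactSupport f) (hf0 : tsupport f ⊆ Ioi 0) :
    Integrable fun y : ℝ => mellin f (-((((1 / 2 : ℝ)) : ℂ) + y * I)) := by
  have h := (verticalIntegrable_mellin hf hfs hf0 (-(1 / 2))).comp_neg
  refine h.congr (Eventually.of_forall fun y => ?_)
  simp only [ofReal_neg]
  congr 1
  push_cast
  ring

/-- The axis transform is square-integrable: `f̃(−(½+i·)) ∈ L²(ℝ)` (bounded × integrable). [cite: Titchmarsh1948, Thm 71–72] -/
theorem memLp_two_mellin_neg_axis (hf : ContDiff ℝ 2 f) (hfs : HasCompactSupport f) (hf0 : tsupport f ⊆ Ioi 0) :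
    MemLp (fun y : ℝ => mellin f (-((((1 / 2 : ℝ)) : ℂ) + y * I))) 2 (volume : Measure ℝ) := by
  set B : ℝ := ∫ t in Ioi (0 : ℝ), t ^ (-(1 / 2 : ℝ) - 1) * ‖f t‖ with hB
  have hB0 : 0 ≤ B := setIntegral_nonneg measurableSet_Ioi fun t ht => mul_nonneg (Real.rpow_nonneg (le_of_lt ht) _) (norm_nonneg _)
  have hi := integrable_mellin_neg_axis hf hfs hf0
  rw [memLp_two_iff_integrable_sq_norm hi.aestronglyMeasurable]
  refine (hi.norm.const_mul B).mono' (hi.aestronglyMeasurable.norm.pow 2) (Eventually.of_forall fun y => ?_)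
  rw [Real.norm_eq_abs, abs_of_nonneg (sq_nonneg _), sq]
  exact mul_le_mul_of_nonneg_right (norm_mellin_neg_axis_le f y) (norm_nonneg _)

end Axis

/-! ## §2 Hilbert-space bookkeeping (generic) -/

section Generic

/-- **The `L²` inner product of two representatives is the pairing integral**: if `x =ᵐ θ` and `x′ =ᵐ θ′` in `L²(μ)` then `⟪x, x′⟫ = ∫ θ′·conj θ dμ` (Mathlib's inner product is
conjugate-linear in the FIRST slot). [folklore] -/
theorem inner_eq_integral_mul_conj {α : Type*} [MeasurableSpace α] {μ : Measure α} (x x' : Lp ℂ 2 μ) {θ θ' : α → ℂ} (hx : (x : α → ℂ) =ᵐ[μ] θ) (hx' : (x' : α → ℂ) =ᵐ[μ] θ') :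
    ⟪x, x'⟫_ℂ = ∫ a, θ' a * conj (θ a) ∂μ := by
  rw [L2.inner_def]
  refine integral_congr_ae ?_
  filter_upwards [hx, hx'] with a ha ha'
  rw [RCLike.inner_apply, ha, ha']

/-- **UNIQUENESS of the Plancherel isometry**: two linear isometries on the closed span `Θ` with `U x_i = v_i` coincide (★ P3a `linearIsometry_eq_of_apply_eq`). [cite: ReedSimonI1980, Thm. I.7] -/
theorem linearIsometry_unique_of_apply_eq {H M : Type*} [NormedAddCommGroup H] [InnerProductSpace ℂ H] [NormedAddCommGroup M] [InnerProductSpace ℂ M] {ι : Type*}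
    (x : ι → H) (v : ι → M) (U U' : (Submodule.span ℂ (Set.range x)).topologicalClosure →ₗᵢ[ℂ] M)
    (hU : ∀ i, U ⟨x i, mem_topologicalClosure_span x i⟩ = v i) (hU' : ∀ i, U' ⟨x i, mem_topologicalClosure_span x i⟩ = v i) : U = U' :=
  linearIsometry_eq_of_apply_eq U U' hU hU'

/-- **CLOSED SPANS OF MUTUALLY ORTHOGONAL FAMILIES ARE ORTHOGONAL** (generic Hilbert space): `⟪x_i, x′_j⟫ = 0` for all `i, j` ⇒ `closure span {x_i} ⟂ closure span {x′_j}`.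
[cite: ReedSimonI1980, §II.3] -/
theorem isOrtho_topologicalClosure_span_of_inner_eq_zero {H : Type*} [NormedAddCommGroup H] [InnerProductSpace ℂ H] {ι ι' : Type*} (x : ι → H) (x' : ι' → H)
    (h : ∀ i j, ⟪x i, x' j⟫_ℂ = 0) : (Submodule.span ℂ (Set.range x)).topologicalClosure ⟂ (Submodule.span ℂ (Set.range x')).topologicalClosure := by
  have h0 : Submodule.span ℂ (Set.range x) ⟂ Submodule.span ℂ (Set.range x') := by
    rw [Submodule.isOrtho_span]
    rintro _ ⟨i, rfl⟩ _ ⟨j, rfl⟩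
    exact h i j
  rw [Submodule.isOrtho_iff_le] at h0 ⊢
  rw [Submodule.orthogonal_closure]
  exact (Submodule.span ℂ (Set.range x)).topologicalClosure_minimal h0 (Submodule.isClosed_orthogonal _)

/-- Rescaling a family by a non-zero scalar does not change its (closed) span: `span {c • u_i} = span {u_i}` — so for `C > 0` the HEAD's `range U` is `closure span {u_i}`. [folklore] -/
theorem span_range_smul_eq {M : Type*} [AddCommGroup M] [Module ℂ M] {ι : Type*} (u : ι → M) {c : ℂ} (hc : c ≠ 0) :
    Submodule.span ℂ (Set.range fun i => c • u i) = Submodule.span ℂ (Set.range u) := by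
  rw [← Set.smul_set_range, Submodule.span_smul_eq_of_isUnit _ _ (isUnit_iff_ne_zero.2 hc)]

end Generic

/-! ## §3 The `L²(X, μ)` classes of the twisted pseudo-Eisenstein series `θ_{f,φ} = E((f∘H)·φ)` -/

section LTwo

variable (L : Type) [Field L] [NumberField L] [IsCMField L]
variable [MeasurableSpace (quasiSplit (↥(maximalRealSubfield L)) L (IsCMField.complexConj L) 2).Adelic] [BorelSpace (quasiSplit (↥(maximalRealSubfield L)) L (IsCMField.complexConj L) 2).Adelic]

/-- **`θ_{f,φ} ∈ L²(X, μ)`** (indeed every `L^p`): for `f ∈ C_c((0,∞))` and a continuous bounded `χ`-section `φ`, the descent `[g] ↦ θ_{f,φ}(g̃⁻¹)` of `θ_{f,φ} = E((f∘H)·φ)` to the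
automorphic quotient is in `L^p(μ)` for every automorphic (finite) `μ` — ★ D0-χ (bounded, Borel, `G(L⁺)`-invariant) + ★ `memLp_quotFun_of_bound`. [cite: MoeglinWaldspurger1995, II.1.2, I.2.13] -/
theorem memLp_quotFun_chiPseudoEisenstein_cm_two (μ : Measure (quasiSplit (↥(maximalRealSubfield L)) L (IsCMField.complexConj L) 2).automorphicQuotient)
    [(quasiSplit (↥(maximalRealSubfield L)) L (IsCMField.complexConj L) 2).IsAutomorphicMeasure μ] (p : ℝ≥0∞)
    {χ : HeckeCharacter L} {φ : (quasiSplit (↥(maximalRealSubfield L)) L (IsCMField.complexConj L) 2).Adelic → ℂ} (hφ : IsChiSection χ φ) (hφc : Continuous φ) {Cφ : ℝ} (hφC : ∀ x, ‖φ x‖ ≤ Cφ)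
    {f : ℝ → ℂ} (hfc : Continuous f) (hfs : HasCompactSupport f) (hf0 : tsupport f ⊆ Ioi 0) :
    MemLp ((quasiSplit (↥(maximalRealSubfield L)) L (IsCMField.complexConj L) 2).quotFun
      (eisensteinSeriesU (fun g : (quasiSplit (↥(maximalRealSubfield L)) L (IsCMField.complexConj L) 2).Adelic => f (borelHeight g : ℝ) * φ g))) p μ := by
  obtain ⟨M₁, hM₁⟩ := exists_bound_eisensteinSeriesU_comp_borelHeight_mul_cm_two L hfc hfs hf0 hφc hφC hφ.toAdelic_mul
  exact memLp_quotFun_of_bound _ μ p hM₁ (measurable_quotFun_of_measurable (measurable_eisensteinSeriesU_comp_borelHeight_mul_cm_two L hfc hfs hf0 hφc hφC)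
    (eisensteinSeriesU_comp_borelHeight_mul_arithmeticSubgroup_mul f hφ.toAdelic_mul)).aestronglyMeasurable

end LTwo

/-! ## §4 The model vectors `u_{f,φ}(y, k) = f̃(−(½+iy))·φ(k)` in `L²(ℝ × K_U)` and their Gram form -/

section Model

variable {K : Type*} [MeasurableSpace K] (μK : Measure K)

/-- **`u_{f,φ} ∈ L²(ℝ × K, dy ⊗ μ_K)`** for `f ∈ C²_c((0,∞))` and a bounded (a.e.-strongly) measurable `φ` on a finite measure space `K` (the compact `K_U` with its Haar probability):
`∫∫ |f̃(−(½+iy))|²|φ(k)|² = ‖f̃‖²_{L²(ℝ)}·‖φ‖²_{L²(K)} < ∞`. [cite: MoeglinWaldspurger1995, II.2.1] -/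
theorem memLp_two_axisModel [IsFiniteMeasure μK] {f : ℝ → ℂ} (hf : ContDiff ℝ 2 f) (hfs : HasCompactSupport f) (hf0 : tsupport f ⊆ Ioi 0)
    {φ : K → ℂ} (hφm : AEStronglyMeasurable φ μK) {Cφ : ℝ} (hφC : ∀ k, ‖φ k‖ ≤ Cφ) :
    MemLp (fun p : ℝ × K => mellin f (-((((1 / 2 : ℝ)) : ℂ) + p.1 * I)) * φ p.2) 2 ((volume : Measure ℝ).prod μK) := by
  have hF := memLp_two_mellin_neg_axis hf hfs hf0
  have hφ2 : MemLp φ 2 μK := MemLp.of_bound hφm Cφ (Eventually.of_forall hφC)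
  have hm : AEStronglyMeasurable (fun p : ℝ × K => mellin f (-((((1 / 2 : ℝ)) : ℂ) + p.1 * I)) * φ p.2) ((volume : Measure ℝ).prod μK) :=
    (hF.aestronglyMeasurable.comp_fst).mul (hφm.comp_snd)
  rw [memLp_two_iff_integrable_sq_norm hm]
  have h1 := (memLp_two_iff_integrable_sq_norm hF.aestronglyMeasurable).1 hF
  have h2 := (memLp_two_iff_integrable_sq_norm hφm).1 hφ2
  refine ((h1.mul_prod h2).congr (Eventually.of_forall fun p => ?_))
  simp only [norm_mul, mul_pow]

/-- **GRAM FORM OF THE MODEL VECTORS**: if `u =ᵐ f̃(−(½+i·)) ⊗ φ` and `u′ =ᵐ f̃′(−(½+i·)) ⊗ φ′` in `L²(ℝ × K)`, then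
`⟪u, u′⟫ = (∫_ℝ f̃′(−(½+iy))·conj f̃(−(½+iy)) dy)·(∫_K φ′·conj φ dμ_K)` (Fubini for a product integrand, Mathlib `integral_prod_mul`). [cite: MoeglinWaldspurger1995, II.2.1] -/
theorem inner_axisModel_eq [SFinite μK] {f f' : ℝ → ℂ} {φ φ' : K → ℂ} (u u' : Lp ℂ 2 ((volume : Measure ℝ).prod μK))
    (hu : (u : ℝ × K → ℂ) =ᵐ[(volume : Measure ℝ).prod μK] fun p => mellin f (-((((1 / 2 : ℝ)) : ℂ) + p.1 * I)) * φ p.2)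
    (hu' : (u' : ℝ × K → ℂ) =ᵐ[(volume : Measure ℝ).prod μK] fun p => mellin f' (-((((1 / 2 : ℝ)) : ℂ) + p.1 * I)) * φ' p.2) :
    ⟪u, u'⟫_ℂ = (∫ y : ℝ, mellin f' (-((((1 / 2 : ℝ)) : ℂ) + y * I)) * conj (mellin f (-((((1 / 2 : ℝ)) : ℂ) + y * I)))) * ∫ k, φ' k * conj (φ k) ∂μK := by
  rw [inner_eq_integral_mul_conj u u' hu hu', ← integral_prod_mul]
  refine integral_congr_ae (Eventually.of_forall fun p => ?_)
  simp only [map_mul]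
  ring

end Model

/-! ## §5 THE HEAD: the Plancherel isometry of an off-dual family from its one-term Gram formula -/

section Head

variable (L : Type) [Field L] [NumberField L] [IsCMField L]
variable [MeasurableSpace (quasiSplit (↥(maximalRealSubfield L)) L (IsCMField.complexConj L) 2).Adelic] [BorelSpace (quasiSplit (↥(maximalRealSubfield L)) L (IsCMField.complexConj L) 2).Adelic]

omit [BorelSpace (quasiSplit (↥(maximalRealSubfield L)) L (IsCMField.complexConj L) 2).Adelic] in
/-- **THE PLANCHEREL ISOMETRY OF AN OFF-DUAL `χ`-FAMILY AT A `K`-TYPE (`U(1,1)_{L∕L⁺}`, MW II.2.4 with no `M`-term).**  Data: a measure `μ` on `X = G(𝔸)∕G(L⁺)`, an s-finite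
measure `μ_K` on the maximal compact `K_U`, an INDEXED FAMILY `(f_i, φ_i)_{i ∈ ι}` (the consumer's choice: `f_i ∈ C²_c((0,∞))` and `φ_i` ranging over the continuous bounded `χ`-sections in
`V(χ, K′, ω) = chiSectionSpace χ K′ ω` gives the `(K′,ω)`-BLOCK of rows 2–4; all sections give the whole family `Θ_χ`), `L²(X,μ)`-representatives `x_i =ᵐ θ_i = E((f_i∘H)·φ_i)` (§3 builds
them) and `L²(ℝ × K_U)`-representatives `u_i =ᵐ f̃_i(−(½+iy))·φ_i(k)` of the models (§4).  HYPOTHESIS = the OFF-DUAL ONE-TERM FORMULA (OD) of ROADCARD (154) §1 in unitary-axis currency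
(C1∕H-χ ∘ §1; the `w = w₀` term killed by Tate's Lemma B ★ GR-χ since `χ·(χʷ)⁻¹` is not a norm twist; §6 converts the `r⁻²dr` and `σ₀`-line currencies):
`hOD : ∫_X θ_i·conj θ_j dμ = C·((2π)⁻¹∫_ℝ f̃_i(−(½+iy))·conj f̃_j(−(½+iy)) dy)·(∫_{K_U} φ_i·conj φ_j dμ_K)`, `C ≥ 0`.  THEN on the closed span `Θ := closure span {x_i}` there is a LINEAR
ISOMETRY **`U : Θ →ₗᵢ[ℂ] L²(ℝ × K_U)` with `U x_i = √(C∕2π) • u_i`** for every `i`, and **`range U = closure span {√(C∕2π) • u_i}`** — the family is ISOMETRIC to the Mellin ⊗ section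
model: purely continuous spectrum, no residual part (★ P3a engine on the Gram identity `⟪x_i, x_j⟫ = ⟪√(C∕2π)u_i, √(C∕2π)u_j⟫` = hOD ∘ §2 ∘ §4).  Unique by `linearIsometry_unique_of_apply_eq`.
[cite: MoeglinWaldspurger1995, II.2.1, II.2.4] [cite: ReedSimonI1980, Thm. I.7] -/
theorem exists_linearIsometry_chiSection_offDual_cm_two
    (μ : Measure (quasiSplit (↥(maximalRealSubfield L)) L (IsCMField.complexConj L) 2).automorphicQuotient)
    (μK : Measure ((standardMaximalCompactGL 2 L).comap (adelicVal (↥(maximalRealSubfield L)) L (IsCMField.complexConj L) 2 ((StdForm.antidiagonal 2).over L)) : Subgroup (quasiSplit (↥(maximalRealSubfield L)) L (IsCMField.complexConj L) 2).Adelic))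
    [SFinite μK]
    {ι : Type*} {f : ι → ℝ → ℂ} {φ : ι → (quasiSplit (↥(maximalRealSubfield L)) L (IsCMField.complexConj L) 2).Adelic → ℂ}
    (x : ι → Lp ℂ 2 μ)
    (hx : ∀ i, (x i : (quasiSplit (↥(maximalRealSubfield L)) L (IsCMField.complexConj L) 2).automorphicQuotient → ℂ) =ᵐ[μ]
      (quasiSplit (↥(maximalRealSubfield L)) L (IsCMField.complexConj L) 2).quotFun
        (eisensteinSeriesU (fun g : (quasiSplit (↥(maximalRealSubfield L)) L (IsCMField.complexConj L) 2).Adelic => f i (borelHeight g : ℝ) * φ i g)))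
    (u : ι → Lp ℂ 2 ((volume : Measure ℝ).prod μK))
    (hu : ∀ i, (u i : ℝ × ((standardMaximalCompactGL 2 L).comap (adelicVal (↥(maximalRealSubfield L)) L (IsCMField.complexConj L) 2 ((StdForm.antidiagonal 2).over L)) : Subgroup (quasiSplit (↥(maximalRealSubfield L)) L (IsCMField.complexConj L) 2).Adelic) → ℂ)
      =ᵐ[(volume : Measure ℝ).prod μK] fun p => mellin (f i) (-((((1 / 2 : ℝ)) : ℂ) + p.1 * I)) * φ i (p.2 : (quasiSplit (↥(maximalRealSubfield L)) L (IsCMField.complexConj L) 2).Adelic))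
    {C : ℝ} (hC : 0 ≤ C)
    (hOD : ∀ i j, ∫ a, (quasiSplit (↥(maximalRealSubfield L)) L (IsCMField.complexConj L) 2).quotFun
          (eisensteinSeriesU (fun g : (quasiSplit (↥(maximalRealSubfield L)) L (IsCMField.complexConj L) 2).Adelic => f i (borelHeight g : ℝ) * φ i g)) a *
        conj ((quasiSplit (↥(maximalRealSubfield L)) L (IsCMField.complexConj L) 2).quotFun
          (eisensteinSeriesU (fun g : (quasiSplit (↥(maximalRealSubfield L)) L (IsCMField.complexConj L) 2).Adelic => f j (borelHeight g : ℝ) * φ j g)) a) ∂μ =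
        (C : ℂ) * (((((2 * π)⁻¹ : ℝ) : ℂ) * ∫ y : ℝ, mellin (f i) (-((((1 / 2 : ℝ)) : ℂ) + y * I)) * conj (mellin (f j) (-((((1 / 2 : ℝ)) : ℂ) + y * I)))) *
          ∫ k, φ i (k : (quasiSplit (↥(maximalRealSubfield L)) L (IsCMField.complexConj L) 2).Adelic) * conj (φ j (k : (quasiSplit (↥(maximalRealSubfield L)) L (IsCMField.complexConj L) 2).Adelic)) ∂μK)) :
    ∃ U : (Submodule.span ℂ (Set.range x)).topologicalClosure →ₗᵢ[ℂ] Lp ℂ 2 ((volume : Measure ℝ).prod μK),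
      (∀ i, U ⟨x i, mem_topologicalClosure_span x i⟩ = ((Real.sqrt (C * (2 * π)⁻¹) : ℝ) : ℂ) • u i) ∧
      Set.range U = ((Submodule.span ℂ (Set.range fun i => ((Real.sqrt (C * (2 * π)⁻¹) : ℝ) : ℂ) • u i)).topologicalClosure : Set (Lp ℂ 2 ((volume : Measure ℝ).prod μK))) := by
  set c : ℝ := Real.sqrt (C * (2 * π)⁻¹) with hc
  have hc2 : ((c : ℂ)) * (c : ℂ) = (C : ℂ) * (((2 * π)⁻¹ : ℝ) : ℂ) := by
    rw [← ofReal_mul, ← sq, hc, Real.sq_sqrt (mul_nonneg hC (inv_nonneg.2 (by positivity)))]; push_cast; ring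
  have hG : ∀ i j, ⟪x i, x j⟫_ℂ = ⟪(c : ℂ) • u i, (c : ℂ) • u j⟫_ℂ := fun i j => by
    have h1 : ⟪x i, x j⟫_ℂ = _ := inner_eq_integral_mul_conj (x i) (x j) (hx i) (hx j)
    have h2 : ⟪u i, u j⟫_ℂ = _ := inner_axisModel_eq μK (φ := fun k => φ i (k : (quasiSplit (↥(maximalRealSubfield L)) L (IsCMField.complexConj L) 2).Adelic))
      (φ' := fun k => φ j (k : (quasiSplit (↥(maximalRealSubfield L)) L (IsCMField.complexConj L) 2).Adelic)) (u i) (u j) (hu i) (hu j)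
    refine h1.trans ((hOD j i).trans ?_)
    rw [inner_smul_left, inner_smul_right, h2, conj_ofReal, ← mul_assoc (c : ℂ), hc2]
    ring
  have hex := exists_linearIsometry_of_inner_eq (H := Lp ℂ 2 μ) (M := Lp ℂ 2 ((volume : Measure ℝ).prod μK)) (x := x) (u := fun i => (c : ℂ) • u i) hG
  obtain ⟨U, -, hU⟩ := hex
  exact ⟨U, hU, range_linearIsometry_eq_topologicalClosure_span (H := Lp ℂ 2 μ) (M := Lp ℂ 2 ((volume : Measure ℝ).prod μK)) (x := x) (u := fun i => (c : ℂ) • u i) U hU⟩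

/-- **THE HYPOTHESES ARE INHABITED (no vacuity)**: the canonical representatives `x_i := [θ_i]` (§2) and `u_i := [f̃_i(−(½+i·)) ⊗ φ_i|_{K_U}]` (§3) exist in `L²`, so the HEAD applies to
them: from (OD) alone, `∃ x u U` with `x_i =ᵐ θ_i`, `u_i =ᵐ` model, `U x_i = √(C∕2π) • u_i`, `range U = closure span`. [cite: MoeglinWaldspurger1995, II.2.4] -/
theorem exists_repr_and_linearIsometry_chiSection_offDual_cm_two
    (μ : Measure (quasiSplit (↥(maximalRealSubfield L)) L (IsCMField.complexConj L) 2).automorphicQuotient) [(quasiSplit (↥(maximalRealSubfield L)) L (IsCMField.complexConj L) 2).IsAutomorphicMeasure μ]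
    (μK : Measure ((standardMaximalCompactGL 2 L).comap (adelicVal (↥(maximalRealSubfield L)) L (IsCMField.complexConj L) 2 ((StdForm.antidiagonal 2).over L)) : Subgroup (quasiSplit (↥(maximalRealSubfield L)) L (IsCMField.complexConj L) 2).Adelic))
    [IsFiniteMeasure μK]
    {ι : Type*} {χ : HeckeCharacter L} {f : ι → ℝ → ℂ} {φ : ι → (quasiSplit (↥(maximalRealSubfield L)) L (IsCMField.complexConj L) 2).Adelic → ℂ}
    (hf : ∀ i, ContDiff ℝ 2 (f i)) (hfs : ∀ i, HasCompactSupport (f i)) (hf0 : ∀ i, tsupport (f i) ⊆ Ioi 0)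
    (hφ : ∀ i, IsChiSection χ (φ i)) (hφc : ∀ i, Continuous (φ i)) (hφC : ∀ i, ∃ Cφ : ℝ, ∀ x, ‖φ i x‖ ≤ Cφ)
    {C : ℝ} (hC : 0 ≤ C)
    (hOD : ∀ i j, ∫ a, (quasiSplit (↥(maximalRealSubfield L)) L (IsCMField.complexConj L) 2).quotFun
          (eisensteinSeriesU (fun g : (quasiSplit (↥(maximalRealSubfield L)) L (IsCMField.complexConj L) 2).Adelic => f i (borelHeight g : ℝ) * φ i g)) a *
        conj ((quasiSplit (↥(maximalRealSubfield L)) L (IsCMField.complexConj L) 2).quotFun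
          (eisensteinSeriesU (fun g : (quasiSplit (↥(maximalRealSubfield L)) L (IsCMField.complexConj L) 2).Adelic => f j (borelHeight g : ℝ) * φ j g)) a) ∂μ =
        (C : ℂ) * (((((2 * π)⁻¹ : ℝ) : ℂ) * ∫ y : ℝ, mellin (f i) (-((((1 / 2 : ℝ)) : ℂ) + y * I)) * conj (mellin (f j) (-((((1 / 2 : ℝ)) : ℂ) + y * I)))) *
          ∫ k, φ i (k : (quasiSplit (↥(maximalRealSubfield L)) L (IsCMField.complexConj L) 2).Adelic) * conj (φ j (k : (quasiSplit (↥(maximalRealSubfield L)) L (IsCMField.complexConj L) 2).Adelic)) ∂μK)) :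
    ∃ (x : ι → Lp ℂ 2 μ) (u : ι → Lp ℂ 2 ((volume : Measure ℝ).prod μK)),
      (∀ i, (x i : (quasiSplit (↥(maximalRealSubfield L)) L (IsCMField.complexConj L) 2).automorphicQuotient → ℂ) =ᵐ[μ]
        (quasiSplit (↥(maximalRealSubfield L)) L (IsCMField.complexConj L) 2).quotFun
          (eisensteinSeriesU (fun g : (quasiSplit (↥(maximalRealSubfield L)) L (IsCMField.complexConj L) 2).Adelic => f i (borelHeight g : ℝ) * φ i g))) ∧
      (∀ i, (u i : ℝ × ((standardMaximalCompactGL 2 L).comap (adelicVal (↥(maximalRealSubfield L)) L (IsCMField.complexConj L) 2 ((StdForm.antidiagonal 2).over L)) : Subgroup (quasiSplit (↥(maximalRealSubfield L)) L (IsCMField.complexConj L) 2).Adelic) → ℂ)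
        =ᵐ[(volume : Measure ℝ).prod μK] fun p => mellin (f i) (-((((1 / 2 : ℝ)) : ℂ) + p.1 * I)) * φ i (p.2 : (quasiSplit (↥(maximalRealSubfield L)) L (IsCMField.complexConj L) 2).Adelic)) ∧
      ∃ U : (Submodule.span ℂ (Set.range x)).topologicalClosure →ₗᵢ[ℂ] Lp ℂ 2 ((volume : Measure ℝ).prod μK),
        (∀ i, U ⟨x i, mem_topologicalClosure_span x i⟩ = ((Real.sqrt (C * (2 * π)⁻¹) : ℝ) : ℂ) • u i) ∧
        Set.range U = ((Submodule.span ℂ (Set.range fun i => ((Real.sqrt (C * (2 * π)⁻¹) : ℝ) : ℂ) • u i)).topologicalClosure : Set (Lp ℂ 2 ((volume : Measure ℝ).prod μK))) := by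
  have hxm : ∀ i, MemLp ((quasiSplit (↥(maximalRealSubfield L)) L (IsCMField.complexConj L) 2).quotFun
      (eisensteinSeriesU (fun g : (quasiSplit (↥(maximalRealSubfield L)) L (IsCMField.complexConj L) 2).Adelic => f i (borelHeight g : ℝ) * φ i g))) 2 μ := fun i => by
    obtain ⟨Cφ, hCφ⟩ := hφC i
    exact memLp_quotFun_chiPseudoEisenstein_cm_two L μ 2 (hφ i) (hφc i) hCφ (hf i).continuous (hfs i) (hf0 i)
  have hum : ∀ i, MemLp (fun p : ℝ × ((standardMaximalCompactGL 2 L).comap (adelicVal (↥(maximalRealSubfield L)) L (IsCMField.complexConj L) 2 ((StdForm.antidiagonal 2).over L)) : Subgroup (quasiSplit (↥(maximalRealSubfield L)) L (IsCMField.complexConj L) 2).Adelic) =>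
      mellin (f i) (-((((1 / 2 : ℝ)) : ℂ) + p.1 * I)) * φ i (p.2 : (quasiSplit (↥(maximalRealSubfield L)) L (IsCMField.complexConj L) 2).Adelic)) 2 ((volume : Measure ℝ).prod μK) := fun i => by
    obtain ⟨Cφ, hCφ⟩ := hφC i
    exact memLp_two_axisModel μK (hf i) (hfs i) (hf0 i) (φ := fun k => φ i (k : (quasiSplit (↥(maximalRealSubfield L)) L (IsCMField.complexConj L) 2).Adelic))
      ((hφc i).comp continuous_subtype_val).aestronglyMeasurable fun k => hCφ _
  refine ⟨fun i => (hxm i).toLp _, fun i => (hum i).toLp _, fun i => MemLp.coeFn_toLp _, fun i => MemLp.coeFn_toLp _, ?_⟩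
  exact exists_linearIsometry_chiSection_offDual_cm_two L μ μK _ (fun i => MemLp.coeFn_toLp _) _ (fun i => MemLp.coeFn_toLp _) hC hOD

end Head

/-! ## §6 Entry points in the `r`-space and `σ₀`-line currencies of the one-term formula, and cross-family orthogonality (XF) -/

section Currencies

variable (L : Type) [Field L] [NumberField L] [IsCMField L]
variable [MeasurableSpace (quasiSplit (↥(maximalRealSubfield L)) L (IsCMField.complexConj L) 2).Adelic] [BorelSpace (quasiSplit (↥(maximalRealSubfield L)) L (IsCMField.complexConj L) 2).Adelic]

omit [BorelSpace (quasiSplit (↥(maximalRealSubfield L)) L (IsCMField.complexConj L) 2).Adelic] in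
/-- **(OD) IN `r`-SPACE CURRENCY ⇒ AXIS CURRENCY**: if the one-term formula is known with the radial pairing `∫_0^∞ f_i·conj f_j·r^{−2} dr` (the shape after ★ C `d𝔞 = d𝔟 dt∕t` and before Parseval),
then it holds in the unitary-axis shape of the HEAD (§1 `setIntegral_mul_conj_mul_cpow_eq_axis`). [cite: MoeglinWaldspurger1995, II.2.1] -/
theorem hOD_axis_of_radial
    {μ : Measure (quasiSplit (↥(maximalRealSubfield L)) L (IsCMField.complexConj L) 2).automorphicQuotient}
    {μK : Measure ((standardMaximalCompactGL 2 L).comap (adelicVal (↥(maximalRealSubfield L)) L (IsCMField.complexConj L) 2 ((StdForm.antidiagonal 2).over L)) : Subgroup (quasiSplit (↥(maximalRealSubfield L)) L (IsCMField.complexConj L) 2).Adelic)}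
    {ι : Type*} {f : ι → ℝ → ℂ} {φ : ι → (quasiSplit (↥(maximalRealSubfield L)) L (IsCMField.complexConj L) 2).Adelic → ℂ}
    (hf : ∀ i, ContDiff ℝ 2 (f i)) (hfs : ∀ i, HasCompactSupport (f i)) (hf0 : ∀ i, tsupport (f i) ⊆ Ioi 0) {C : ℂ}
    (hODr : ∀ i j, ∫ a, (quasiSplit (↥(maximalRealSubfield L)) L (IsCMField.complexConj L) 2).quotFun
          (eisensteinSeriesU (fun g : (quasiSplit (↥(maximalRealSubfield L)) L (IsCMField.complexConj L) 2).Adelic => f i (borelHeight g : ℝ) * φ i g)) a *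
        conj ((quasiSplit (↥(maximalRealSubfield L)) L (IsCMField.complexConj L) 2).quotFun
          (eisensteinSeriesU (fun g : (quasiSplit (↥(maximalRealSubfield L)) L (IsCMField.complexConj L) 2).Adelic => f j (borelHeight g : ℝ) * φ j g)) a) ∂μ =
        C * ((∫ r in Ioi (0 : ℝ), f i r * conj (f j r) * (r : ℂ) ^ (-2 : ℂ)) *
          ∫ k, φ i (k : (quasiSplit (↥(maximalRealSubfield L)) L (IsCMField.complexConj L) 2).Adelic) * conj (φ j (k : (quasiSplit (↥(maximalRealSubfield L)) L (IsCMField.complexConj L) 2).Adelic)) ∂μK))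
    (i j : ι) :
    ∫ a, (quasiSplit (↥(maximalRealSubfield L)) L (IsCMField.complexConj L) 2).quotFun
          (eisensteinSeriesU (fun g : (quasiSplit (↥(maximalRealSubfield L)) L (IsCMField.complexConj L) 2).Adelic => f i (borelHeight g : ℝ) * φ i g)) a *
        conj ((quasiSplit (↥(maximalRealSubfield L)) L (IsCMField.complexConj L) 2).quotFun
          (eisensteinSeriesU (fun g : (quasiSplit (↥(maximalRealSubfield L)) L (IsCMField.complexConj L) 2).Adelic => f j (borelHeight g : ℝ) * φ j g)) a) ∂μ =
        C * (((((2 * π)⁻¹ : ℝ) : ℂ) * ∫ y : ℝ, mellin (f i) (-((((1 / 2 : ℝ)) : ℂ) + y * I)) * conj (mellin (f j) (-((((1 / 2 : ℝ)) : ℂ) + y * I)))) *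
          ∫ k, φ i (k : (quasiSplit (↥(maximalRealSubfield L)) L (IsCMField.complexConj L) 2).Adelic) * conj (φ j (k : (quasiSplit (↥(maximalRealSubfield L)) L (IsCMField.complexConj L) 2).Adelic)) ∂μK) := by
  rw [hODr i j, setIntegral_mul_conj_mul_cpow_eq_axis (hf i) (hfs i) (hf0 i) (hf j).continuous (hfs j) (hf0 j)]

omit [BorelSpace (quasiSplit (↥(maximalRealSubfield L)) L (IsCMField.complexConj L) 2).Adelic] in
/-- **(OD) IN `σ₀`-LINE CURRENCY ⇒ AXIS CURRENCY**: the one-term formula in ★ Final's vertical-line shape `(2π)⁻¹∫_ℝ f̃_i(z)·conj(mellin f_j (z̄ − 1)) dy` (`z = σ₀ + iy`, any `σ₀`, e.g. the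
unfolding line `σ₀ > 1`) gives the axis shape of the HEAD (★ A PARSEVAL I at `σ₀` and at `½`). [cite: MoeglinWaldspurger1995, II.2.1] -/
theorem hOD_axis_of_line
    {μ : Measure (quasiSplit (↥(maximalRealSubfield L)) L (IsCMField.complexConj L) 2).automorphicQuotient}
    {μK : Measure ((standardMaximalCompactGL 2 L).comap (adelicVal (↥(maximalRealSubfield L)) L (IsCMField.complexConj L) 2 ((StdForm.antidiagonal 2).over L)) : Subgroup (quasiSplit (↥(maximalRealSubfield L)) L (IsCMField.complexConj L) 2).Adelic)}
    {ι : Type*} {f : ι → ℝ → ℂ} {φ : ι → (quasiSplit (↥(maximalRealSubfield L)) L (IsCMField.complexConj L) 2).Adelic → ℂ}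
    (hf : ∀ i, ContDiff ℝ 2 (f i)) (hfs : ∀ i, HasCompactSupport (f i)) (hf0 : ∀ i, tsupport (f i) ⊆ Ioi 0) {C : ℂ} {σ₀ : ℝ}
    (hODl : ∀ i j, ∫ a, (quasiSplit (↥(maximalRealSubfield L)) L (IsCMField.complexConj L) 2).quotFun
          (eisensteinSeriesU (fun g : (quasiSplit (↥(maximalRealSubfield L)) L (IsCMField.complexConj L) 2).Adelic => f i (borelHeight g : ℝ) * φ i g)) a *
        conj ((quasiSplit (↥(maximalRealSubfield L)) L (IsCMField.complexConj L) 2).quotFun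
          (eisensteinSeriesU (fun g : (quasiSplit (↥(maximalRealSubfield L)) L (IsCMField.complexConj L) 2).Adelic => f j (borelHeight g : ℝ) * φ j g)) a) ∂μ =
        C * (((((2 * π)⁻¹ : ℝ) : ℂ) * ∫ y : ℝ, mellin (f i) (-((σ₀ : ℂ) + y * I)) * conj (mellin (f j) (conj ((σ₀ : ℂ) + y * I) - 1))) *
          ∫ k, φ i (k : (quasiSplit (↥(maximalRealSubfield L)) L (IsCMField.complexConj L) 2).Adelic) * conj (φ j (k : (quasiSplit (↥(maximalRealSubfield L)) L (IsCMField.complexConj L) 2).Adelic)) ∂μK))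
    (i j : ι) :
    ∫ a, (quasiSplit (↥(maximalRealSubfield L)) L (IsCMField.complexConj L) 2).quotFun
          (eisensteinSeriesU (fun g : (quasiSplit (↥(maximalRealSubfield L)) L (IsCMField.complexConj L) 2).Adelic => f i (borelHeight g : ℝ) * φ i g)) a *
        conj ((quasiSplit (↥(maximalRealSubfield L)) L (IsCMField.complexConj L) 2).quotFun
          (eisensteinSeriesU (fun g : (quasiSplit (↥(maximalRealSubfield L)) L (IsCMField.complexConj L) 2).Adelic => f j (borelHeight g : ℝ) * φ j g)) a) ∂μ =
        C * (((((2 * π)⁻¹ : ℝ) : ℂ) * ∫ y : ℝ, mellin (f i) (-((((1 / 2 : ℝ)) : ℂ) + y * I)) * conj (mellin (f j) (-((((1 / 2 : ℝ)) : ℂ) + y * I)))) *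
          ∫ k, φ i (k : (quasiSplit (↥(maximalRealSubfield L)) L (IsCMField.complexConj L) 2).Adelic) * conj (φ j (k : (quasiSplit (↥(maximalRealSubfield L)) L (IsCMField.complexConj L) 2).Adelic)) ∂μK) := by
  rw [hODl i j, ← setIntegral_mul_conj_mul_cpow_eq (hf i) (hfs i) (hf0 i) (hf j).continuous (hfs j) (hf0 j) σ₀,
    setIntegral_mul_conj_mul_cpow_eq_axis (hf i) (hfs i) (hf0 i) (hf j).continuous (hfs j) (hf0 j)]

omit [MeasurableSpace (quasiSplit (↥(maximalRealSubfield L)) L (IsCMField.complexConj L) 2).Adelic] [BorelSpace (quasiSplit (↥(maximalRealSubfield L)) L (IsCMField.complexConj L) 2).Adelic] in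
/-- **CROSS-FAMILY ORTHOGONALITY (XF) ⇒ `Θ_χ ⟂ Θ_{χ′}`**: if the pairing of every `θ_i = E((f_i∘H)·φ_i)` (`χ`-family) with every `θ′_j = E((f′_j∘H)·φ′_j)` (`χ′`-family) vanishes —
ROADCARD (154) §1 (XF): both character integrals `χ·conj χ′` and `χ·conj χ′ʷ` over `𝓕_I` die by Tate's Lemma B ★ GR-χ when `χ′ ∉ {χ, χʷ}` up to norm twists — then the closed spans of
their `L²(X,μ)` classes are ORTHOGONAL closed subspaces: `closure span {x_i} ⟂ closure span {x′_j}`. [cite: MoeglinWaldspurger1995, II.2.1] [cite: TateThesis1967, Thm. 4.4.1] -/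
theorem isOrtho_chiSection_families_cm_two
    {μ : Measure (quasiSplit (↥(maximalRealSubfield L)) L (IsCMField.complexConj L) 2).automorphicQuotient}
    {ι ι' : Type*} {f : ι → ℝ → ℂ} {φ : ι → (quasiSplit (↥(maximalRealSubfield L)) L (IsCMField.complexConj L) 2).Adelic → ℂ}
    {f' : ι' → ℝ → ℂ} {φ' : ι' → (quasiSplit (↥(maximalRealSubfield L)) L (IsCMField.complexConj L) 2).Adelic → ℂ}
    (x : ι → Lp ℂ 2 μ)
    (hx : ∀ i, (x i : (quasiSplit (↥(maximalRealSubfield L)) L (IsCMField.complexConj L) 2).automorphicQuotient → ℂ) =ᵐ[μ]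
      (quasiSplit (↥(maximalRealSubfield L)) L (IsCMField.complexConj L) 2).quotFun
        (eisensteinSeriesU (fun g : (quasiSplit (↥(maximalRealSubfield L)) L (IsCMField.complexConj L) 2).Adelic => f i (borelHeight g : ℝ) * φ i g)))
    (x' : ι' → Lp ℂ 2 μ)
    (hx' : ∀ j, (x' j : (quasiSplit (↥(maximalRealSubfield L)) L (IsCMField.complexConj L) 2).automorphicQuotient → ℂ) =ᵐ[μ]
      (quasiSplit (↥(maximalRealSubfield L)) L (IsCMField.complexConj L) 2).quotFun
        (eisensteinSeriesU (fun g : (quasiSplit (↥(maximalRealSubfield L)) L (IsCMField.complexConj L) 2).Adelic => f' j (borelHeight g : ℝ) * φ' j g)))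
    (hXF : ∀ i j, ∫ a, (quasiSplit (↥(maximalRealSubfield L)) L (IsCMField.complexConj L) 2).quotFun
          (eisensteinSeriesU (fun g : (quasiSplit (↥(maximalRealSubfield L)) L (IsCMField.complexConj L) 2).Adelic => f' j (borelHeight g : ℝ) * φ' j g)) a *
        conj ((quasiSplit (↥(maximalRealSubfield L)) L (IsCMField.complexConj L) 2).quotFun
          (eisensteinSeriesU (fun g : (quasiSplit (↥(maximalRealSubfield L)) L (IsCMField.complexConj L) 2).Adelic => f i (borelHeight g : ℝ) * φ i g)) a) ∂μ = 0) :
    (Submodule.span ℂ (Set.range x)).topologicalClosure ⟂ (Submodule.span ℂ (Set.range x')).topologicalClosure :=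
  isOrtho_topologicalClosure_span_of_inner_eq_zero x x' fun i j => by rw [inner_eq_integral_mul_conj (x i) (x' j) (hx i) (hx' j), hXF i j]

end Currencies

end Summit.HodgeConjecture.HodgeConjecture.Cruxes.H413.K2E1ChiSectionPlancherelKTypeCMTwo

end
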